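import Summits.AnomalousDissipation.AnomalousDissipation.Theses.SawtoothPulseCascade
import Summits.AnomalousDissipation.AnomalousDissipation.Theorems.SawtoothPulseCascadeK3LocalisedClosureDriftFreeClosure
import Summits.AnomalousDissipation.AnomalousDissipation.Theorems.SawtoothPulseCascadeK3LocalisedClosureExistence
import Summits.AnomalousDissipation.AnomalousDissipation.Theorems.SawtoothPulseCascadeConstructionRegular58
import Summits.AnomalousDissipation.AnomalousDissipation.Theorems.SawtoothPulseCascadeLipAgmonApproxSolP
import Summits.AnomalousDissipation.AnomalousDissipation.Theorems.SawtoothPulseCascadeK1LocalisedCascadeK1locPrimeCTG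
import Summits.AnomalousDissipation.AnomalousDissipation.Theorems.SawtoothPulseCascadeLipAgmonApproxSolPC
import Summits.AnomalousDissipation.AnomalousDissipation.Theorems.SawtoothPulseCascadeLipAgmonApproxSolPH

/-!
# The rung `Target` from K1loc and K2″ at ONE parameter point with SYMBOLIC corner rounding `δ₀` (K3loc′, shape P)
(route `AnomalousDissipation/SawtoothPulseCascade`; helper for the crux K1loc = stmt-AnomalousDissipation-19491 —
ROUND-18 §C/§D of the K1loc arbiter: the δ₀-generalisation of the pointwise closure)

The landed closure of the route (`k3LocalisedClosure_proof` = `k3LocalisedClosure_of_approxSol_two approxSol58_two_of`) is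
POINTWISE but hard-coded at the box point `⟨5, 1/4, 2, 1, 2⟩`, while the K1loc chain of record (closers
`K1Window.k1Localised_of_phase2_only_sharp` / the CT-GEO certificate) proves `K1Localised P (P.γ² − 3)` for
`P.γ = 8`, `0 < P.δ₀ ≤ 2⁻¹⁰⁰`, `(P.d, P.N₀, P.ρN) = (2, 1, 2)` — shape P of the arbiter's restatement
(`K1loc′ := ∃ δ₀ ∈ Ioc 0 (1/4), ∃ γ ∈ Icc 5 8, CascadeFieldSmooth ⟨γ,δ₀,2,1,2⟩ ∧ K1Localised ⟨γ,δ₀,2,1,2⟩ (γ²−3)`).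
This file re-runs the closure with `δ₀` (and `γ`) symbolic, so that K1loc′ and K2″ at the same point reach `Target`:

* `target_of_approxSol_params` — `Target` from `CascadeFieldSmooth P`, `K1Localised P r` and `ApproximateSolution P r`
  at ANY admissible `P` (`0 < δ₀`, `0 < d`, `1 ≤ N₀`, `2 ≤ ρN`): the landed generic bricks `Theorems.constructionRegular`,
  `DriftFreeExistence.existence_of_params`, `DriftFreeClosure.exists_norm_planarForce_le` /
  `planarAnomalousFamily_of` and the 2½-D lift `DriftFree.liftClassical`, verbatim as in `k3LocalisedClosure_of_approxSol_point`;
* `target_of_k1Localised_P` — `Target` from `K1Localised P (P.γ²−3)` and `K2PhaseGrowthClassical P 3` for every `P` with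
  `P.γ ∈ [5,8]`, `0 < P.δ₀`, `(P.d, P.N₀, P.ρN) = (2, 1, 2)` (the approximate solution supplied by
  `LipAgmon.approximateSolution_P`; NO upper bound on `δ₀` is needed);
* `k3LocalisedClosureP` — verbatim the arbiter's `K3LocalisedClosureP` (ROUND-18 §C):
  `∀ δ₀ ∈ Ioc 0 (1/4), ∀ γ ∈ Icc 5 8, (CascadeFieldSmooth ∧ K1Localised)(γ,δ₀,2) (γ²−3) → K2PhaseGrowthClassical (γ,δ₀,2) 3 → Target`;
* `target_of_K1locP_K2P` — the glue `closesP`: K1loc′ → K2′ → Target;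
* `target_of_K2_at_ctg_point` / `target_of_K2LinearisedCascadeGrowthP` — with K1loc′ a THEOREM (`K1Window.k1Localised_ctg`,
  p663045, γ = 8, δ₀ ≤ 2⁻¹⁰⁰) the rung `Target` follows from K2″ ALONE at that one point (a fortiori from K2′);
* the C-knob (sequel §): `target_of_k1Localised_PC`, `target_of_K2cap_at_ctg_point` (any cap `C ≤ 5` at the K1 point),
  `target_of_K2cap_five : K2PhaseGrowthClassical ⟨8,δ₀,2,1,2⟩ 5 → Target`, `k3LocalisedClosurePC`;
* the weakest K2 of record (sequel §, receptacle `K2PhaseGrowthClassicalH` = cap only below the horizon, ν₀ per lag):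
  `target_of_k1Localised_PH`, `pointClosureH`, `target_of_K2H_at_ctg_point`, `target_of_K2H_five`, `target_of_K2GrowthCtgPointH`.
-/

set_option linter.dupNamespace false

noncomputable section

namespace Summit.AnomalousDissipation.AnomalousDissipation.Theorems.SawtoothPulseCascade

open Set
open Literature.Analysis Literature.Analysis.FunctionSpaces Literature.Analysis.FluidPDE
open Literature.Analysis.FluidPDE.SawtoothCascade
open Summit.AnomalousDissipation.AnomalousDissipation.Theses.SawtoothPulseCascade

/-- **The rung `Target` from the smooth carrier, K1loc and the approximate solution at ANY admissible parameter point**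
(`0 < δ₀`, `0 < d`, `1 ≤ N₀`, `2 ≤ ρN`, any rate `r`): the packaging (`Theorems.constructionRegular`,
`DriftFreeExistence.existence_of_params`), the drift-free closure `DriftFreeClosure.planarAnomalousFamily_of` with the force
bound `exists_norm_planarForce_le`, and the 2½-D lift `DriftFree.liftClassical` — the proof of
`k3LocalisedClosure_of_approxSol_point` with the point made a parameter. -/
theorem target_of_approxSol_params (P : CascadeParams) (hδ₀ : 0 < P.δ₀) (hd : 0 < P.d) (hN₀ : 1 ≤ P.N₀)
    (hρ : 2 ≤ P.ρN) {r : ℝ} (hfs : CascadeFieldSmooth P) (hK1 : K1Localised P r)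
    (hA : DriftFree.ApproximateSolution P r) : Target := by
  obtain ⟨hdat, hfs', hhold⟩ := Summit.AnomalousDissipation.AnomalousDissipation.Theorems.constructionRegular P hδ₀ hd hN₀ hρ
  have hex := DriftFreeExistence.existence_of_params P hδ₀ hd hN₀ hρ
  obtain ⟨C, hC⟩ := DriftFreeClosure.exists_norm_planarForce_le P hδ₀ hd hN₀ hρ
  have hfam := DriftFreeClosure.planarAnomalousFamily_of hfs hK1 hex hA hC
  obtain ⟨ν, hν, V, φ, R, hm, hAD⟩ := hfam
  refine ⟨ν, Literature.Analysis.FluidPDE.SawtoothCascade.DriftFree.liftedDatum,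
    Literature.Analysis.FluidPDE.SawtoothCascade.DriftFree.liftedForce P,
    fun m t => Literature.Analysis.FunctionSpaces.Torus.twoHalf (V m t) (R m t),
    fun m t => φ m t ∘ Literature.Analysis.FunctionSpaces.Torus.planarProj, hν, hdat, hhold, hfs',
    fun m => ⟨?_, ?_, (hm m).2.2.2.2⟩, hAD⟩
  · exact Literature.Analysis.FluidPDE.SawtoothCascade.DriftFree.liftClassical _ _ _ _ _ (hm m).1 (hm m).2.2.1
  · show Literature.Analysis.FunctionSpaces.Torus.twoHalf (V m 0) (R m 0) =
        Literature.Analysis.FluidPDE.SawtoothCascade.DriftFree.liftedDatum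
    rw [(hm m).2.1, (hm m).2.2.2.1]
    rfl

/-- **`Target` from K1loc and K2″ at one point of the line `ρN = 2` with symbolic corner rounding**: for every
`P` with `P.γ ∈ [5,8]`, `0 < P.δ₀`, `(P.d, P.N₀, P.ρN) = (2, 1, 2)`, `K1Localised P (P.γ²−3)` and `K2PhaseGrowthClassical P 3`
imply the rung `Target` — the carrier is smooth (`cascadeFieldSmooth`), the approximate solution comes from K2″ alone
(`LipAgmon.approximateSolution_P`), and `target_of_approxSol_params` closes.  This is the form the K1loc chain of record
plugs into (`K1Window.k1Localised_of_phase…` conclude `K1Localised P (P.γ ^ 2 - 3)` under exactly these parameter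
equations, with `P.γ = 8` and `P.δ₀ ≤ 2⁻¹⁰⁰`). -/
theorem target_of_k1Localised_P (P : CascadeParams) (hγ : P.γ ∈ Set.Icc (5 : ℝ) 8) (hδ₀ : 0 < P.δ₀) (hd : P.d = 2)
    (hN₀ : P.N₀ = 1) (hρN : P.ρN = 2) (hK1 : K1Localised P (P.γ ^ 2 - 3)) (hK2 : K2PhaseGrowthClassical P 3) :
    Target := by
  obtain ⟨γ, δ₀, d, N₀, ρN⟩ := P
  simp only at hγ hδ₀ hd hN₀ hρN hK1 hK2
  subst hd hN₀ hρN
  exact target_of_approxSol_params ⟨γ, δ₀, 2, 1, 2⟩ hδ₀ (by norm_num) le_rfl le_rfl (cascadeFieldSmooth _ hδ₀ (by norm_num))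
    hK1 (LipAgmon.approximateSolution_P hγ hδ₀ hK2)

/-- **K3loc′ at one point** (`ρN = 2`, `δ₀ ∈ (0, 1/4]`, `γ ∈ [5,8]`): `CascadeFieldSmooth ∧ K1Localised` and `K2″` at
`⟨γ, δ₀, 2, 1, 2⟩` give `Target`. -/
theorem target_of_pointP {δ₀ : ℝ} (hδ₀ : δ₀ ∈ Set.Ioc (0 : ℝ) (1 / 4)) {γ : ℝ} (hγ : γ ∈ Set.Icc (5 : ℝ) 8)
    (h1 : CascadeFieldSmooth ⟨γ, δ₀, 2, 1, 2⟩ ∧ K1Localised ⟨γ, δ₀, 2, 1, 2⟩ (γ ^ 2 - 3))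
    (hK2 : K2PhaseGrowthClassical ⟨γ, δ₀, 2, 1, 2⟩ 3) : Target :=
  target_of_k1Localised_P ⟨γ, δ₀, 2, 1, 2⟩ hγ hδ₀.1 rfl rfl rfl h1.2 hK2

/-- **K3loc′ (shape P of the K1loc arbiter's restatement, ROUND-18 §C `K3LocalisedClosureP`), PROVED**: for every corner
rounding `δ₀ ∈ (0, 1/4]` and every `γ ∈ [5,8]`, `(CascadeFieldSmooth ∧ K1Localised)(⟨γ,δ₀,2,1,2⟩, γ²−3)` and
`K2PhaseGrowthClassical ⟨γ,δ₀,2,1,2⟩ 3` imply the rung `Target`.  (The landed `k3LocalisedClosure_proof` is the instance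
`δ₀ = 1/4` read through the box items.) -/
theorem k3LocalisedClosureP :
    ∀ δ₀ ∈ Set.Ioc (0 : ℝ) (1 / 4), ∀ γ ∈ Set.Icc (5 : ℝ) 8,
      (CascadeFieldSmooth ⟨γ, δ₀, 2, 1, 2⟩ ∧ K1Localised ⟨γ, δ₀, 2, 1, 2⟩ (γ ^ 2 - 3)) →
      K2PhaseGrowthClassical ⟨γ, δ₀, 2, 1, 2⟩ 3 → Target :=
  fun _ hδ₀ _ hγ h1 hK2 => target_of_pointP hδ₀ hγ h1 hK2

/-- **The glue `closesP` of the restated route** (ROUND-18 §C): K1loc′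
(`∃ δ₀ ∈ Ioc 0 (1/4), ∃ γ ∈ Icc 5 8, CascadeFieldSmooth ⟨γ,δ₀,2,1,2⟩ ∧ K1Localised ⟨γ,δ₀,2,1,2⟩ (γ²−3)`) and K2′
(`∀ δ₀ ∈ Ioc 0 (1/4), ∀ γ ∈ Icc 5 8, K2PhaseGrowthClassical ⟨γ,δ₀,2,1,2⟩ 3`) imply `Target`. -/
theorem target_of_K1locP_K2P
    (hK1 : ∃ δ₀ ∈ Set.Ioc (0 : ℝ) (1 / 4), ∃ γ ∈ Set.Icc (5 : ℝ) 8,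
      CascadeFieldSmooth ⟨γ, δ₀, 2, 1, 2⟩ ∧ K1Localised ⟨γ, δ₀, 2, 1, 2⟩ (γ ^ 2 - 3))
    (hK2 : ∀ δ₀ ∈ Set.Ioc (0 : ℝ) (1 / 4), ∀ γ ∈ Set.Icc (5 : ℝ) 8, K2PhaseGrowthClassical ⟨γ, δ₀, 2, 1, 2⟩ 3) :
    Target := by
  obtain ⟨δ₀, hδ₀, γ, hγ, h1⟩ := hK1
  exact k3LocalisedClosureP δ₀ hδ₀ γ hγ h1 (hK2 δ₀ hδ₀ γ hγ)

/-- **`Target` from the K1loc chain's output shape at `γ = 8`**: `K1Localised ⟨8, δ₀, 2, 1, 2⟩ 61` at some corner rounding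
`δ₀ > 0` (the closers of record deliver it for `δ₀ ≤ 2⁻¹⁰⁰`) together with K2″ at the same point gives the rung `Target`. -/
theorem target_of_k1Localised_eight {δ₀ : ℝ} (hδ₀ : 0 < δ₀) (hK1 : K1Localised ⟨8, δ₀, 2, 1, 2⟩ 61)
    (hK2 : K2PhaseGrowthClassical ⟨8, δ₀, 2, 1, 2⟩ 3) : Target := by
  have h61 : ((⟨8, δ₀, 2, 1, 2⟩ : CascadeParams).γ) ^ 2 - 3 = 61 := by norm_num
  exact target_of_k1Localised_P ⟨8, δ₀, 2, 1, 2⟩ ⟨by norm_num, by norm_num⟩ hδ₀ rfl rfl rfl (by rw [h61]; exact hK1) hK2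

/-- **K1loc′ (shape P) from the chain's output at one admissible point**: `K1Localised ⟨γ, δ₀, 2, 1, 2⟩ (γ²−3)` at some
`δ₀ ∈ (0, 1/4]`, `γ ∈ [5,8]` gives the restated crux
`∃ δ₀ ∈ Ioc 0 (1/4), ∃ γ ∈ Icc 5 8, CascadeFieldSmooth ⟨γ,δ₀,2,1,2⟩ ∧ K1Localised ⟨γ,δ₀,2,1,2⟩ (γ²−3)` (the smoothness
conjunct is the tree theorem `cascadeFieldSmooth`). -/
theorem k1LocalisedCascadeP_of_point {δ₀ : ℝ} (hδ₀ : δ₀ ∈ Set.Ioc (0 : ℝ) (1 / 4)) {γ : ℝ} (hγ : γ ∈ Set.Icc (5 : ℝ) 8)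
    (hK1 : K1Localised ⟨γ, δ₀, 2, 1, 2⟩ (γ ^ 2 - 3)) :
    ∃ δ₀ ∈ Set.Ioc (0 : ℝ) (1 / 4), ∃ γ ∈ Set.Icc (5 : ℝ) 8,
      CascadeFieldSmooth ⟨γ, δ₀, 2, 1, 2⟩ ∧ K1Localised ⟨γ, δ₀, 2, 1, 2⟩ (γ ^ 2 - 3) :=
  ⟨δ₀, hδ₀, γ, hγ, cascadeFieldSmooth _ hδ₀.1 (by norm_num), hK1⟩

/-- **The route modulo K2″ at ONE point.**  K1loc′ is a theorem of the tree (`K1Window.k1Localised_ctg`, p663045: `P.γ = 8`,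
`0 < P.δ₀ ≤ 2⁻¹⁰⁰`, `(P.d, P.N₀, P.ρN) = (2, 1, 2)`), so for any such `P` the classical per-phase cap
`K2PhaseGrowthClassical P 3` ALONE implies the rung `Target`. -/
theorem target_of_K2_at_ctg_point (P : CascadeParams) (hγ : P.γ = 8) (hδ₀ : 0 < P.δ₀) (hδ₀' : P.δ₀ ≤ (2 : ℝ)⁻¹ ^ 100)
    (hd : P.d = 2) (hN₀ : P.N₀ = 1) (hρN : P.ρN = 2) (hK2 : K2PhaseGrowthClassical P 3) : Target :=
  target_of_k1Localised_P P (by rw [hγ]; norm_num) hδ₀ hd hN₀ hρN (K1Window.k1Localised_ctg P hγ hδ₀ hδ₀' hd hN₀ hρN) hK2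

/-- **The route modulo K2′** (shape P): `∀ δ₀ ∈ Ioc 0 (1/4), ∀ γ ∈ Icc 5 8, K2PhaseGrowthClassical ⟨γ,δ₀,2,1,2⟩ 3` implies
`Target` (used at the single point `(γ, δ₀) = (8, 2⁻¹⁰⁰)` of the K1loc′ theorem). -/
theorem target_of_K2LinearisedCascadeGrowthP
    (hK2 : ∀ δ₀ ∈ Set.Ioc (0 : ℝ) (1 / 4), ∀ γ ∈ Set.Icc (5 : ℝ) 8, K2PhaseGrowthClassical ⟨γ, δ₀, 2, 1, 2⟩ 3) :
    Target :=
  target_of_K2_at_ctg_point ⟨8, (2 : ℝ)⁻¹ ^ 100, 2, 1, 2⟩ rfl (by positivity) le_rfl rfl rfl rfl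
    (hK2 _ ⟨by positivity, by norm_num⟩ 8 ⟨by norm_num, le_rfl⟩)

/-! ## The C-knob: a K2-cap with symbolic constant (sequel; `LipAgmon.approximateSolution_PC`) -/

/-- **`Target` from K1loc and a K2-cap with symbolic constant at one point** (`P.γ ∈ [5,8]`, `0 < P.δ₀`,
`(P.d, P.N₀, P.ρN) = (2,1,2)`, `0 ≤ C`, `C·e^{σ⋆ P.γ} < P.γ² − 3`): `K1Localised P (P.γ²−3)` and
`K2PhaseGrowthClassical P C` imply the rung `Target` (`target_of_approxSol_params` with `LipAgmon.approximateSolution_PC`). -/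
theorem target_of_k1Localised_PC (P : CascadeParams) (hγ : P.γ ∈ Set.Icc (5 : ℝ) 8) (hδ₀ : 0 < P.δ₀) (hd : P.d = 2)
    (hN₀ : P.N₀ = 1) (hρN : P.ρN = 2) {C : ℝ} (hC0 : 0 ≤ C) (hCr : C * Real.exp (sawSigmaStar * P.γ) < P.γ ^ 2 - 3)
    (hK1 : K1Localised P (P.γ ^ 2 - 3)) (hK2 : K2PhaseGrowthClassical P C) : Target := by
  obtain ⟨γ, δ₀, d, N₀, ρN⟩ := P
  simp only at hγ hδ₀ hd hN₀ hρN hCr hK1 hK2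
  subst hd hN₀ hρN
  exact target_of_approxSol_params ⟨γ, δ₀, 2, 1, 2⟩ hδ₀ (by norm_num) le_rfl le_rfl (cascadeFieldSmooth _ hδ₀ (by norm_num))
    hK1 (LipAgmon.approximateSolution_PC hγ hδ₀ hC0 hCr hK2)

/-- **The route modulo a K2-cap `C ≤ 5` at ONE point.**  K1loc′ is a theorem (`K1Window.k1Localised_ctg`, p663045:
`P.γ = 8`, `0 < P.δ₀ ≤ 2⁻¹⁰⁰`, `(P.d, P.N₀, P.ρN) = (2,1,2)`); for any such `P` and any `0 ≤ C ≤ 5` the cap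
`K2PhaseGrowthClassical P C` ALONE implies `Target` (`cap_window_eight`: `5·e^{8σ⋆} ≤ 59.625 < 61 = 8² − 3`). -/
theorem target_of_K2cap_at_ctg_point (P : CascadeParams) (hγ : P.γ = 8) (hδ₀ : 0 < P.δ₀) (hδ₀' : P.δ₀ ≤ (2 : ℝ)⁻¹ ^ 100)
    (hd : P.d = 2) (hN₀ : P.N₀ = 1) (hρN : P.ρN = 2) {C : ℝ} (hC0 : 0 ≤ C) (hC5 : C ≤ 5)
    (hK2 : K2PhaseGrowthClassical P C) : Target := by
  have hCr : C * Real.exp (sawSigmaStar * P.γ) < P.γ ^ 2 - 3 := by rw [hγ]; exact cap_window_eight hC5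
  exact target_of_k1Localised_PC P (by rw [hγ]; norm_num) hδ₀ hd hN₀ hρN hC0 hCr
    (K1Window.k1Localised_ctg P hγ hδ₀ hδ₀' hd hN₀ hρN) hK2

/-- **Headline of the C-knob**: `K2PhaseGrowthClassical ⟨8, δ₀, 2, 1, 2⟩ 5 → Target` for every `δ₀ ∈ (0, 2⁻¹⁰⁰]` — the
per-phase Kelvin–Helmholtz cap of the linearised cascade may be as large as `5·e^{8σ⋆} ≈ 59.6` (vs `3·e^{8σ⋆} ≈ 35.8`
in the drafted K2 item) and the route still closes at the K1 witness point; smaller constants follow by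
`K2PhaseGrowthClassical.mono`. -/
theorem target_of_K2cap_five {δ₀ : ℝ} (hδ₀ : 0 < δ₀) (hδ₀' : δ₀ ≤ (2 : ℝ)⁻¹ ^ 100)
    (hK2 : K2PhaseGrowthClassical ⟨8, δ₀, 2, 1, 2⟩ 5) : Target :=
  target_of_K2cap_at_ctg_point ⟨8, δ₀, 2, 1, 2⟩ rfl hδ₀ hδ₀' rfl rfl rfl (by norm_num) le_rfl hK2

/-- The C-knob form of K3loc′: for `δ₀ ∈ (0, 1/4]`, `γ ∈ [5,8]` and any cap `0 ≤ C` with `C·e^{σ⋆γ} < γ² − 3`,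
`(CascadeFieldSmooth ∧ K1Localised)(⟨γ,δ₀,2,1,2⟩, γ²−3)` and `K2PhaseGrowthClassical ⟨γ,δ₀,2,1,2⟩ C` give `Target`. -/
theorem k3LocalisedClosurePC {C : ℝ} (hC0 : 0 ≤ C) :
    ∀ δ₀ ∈ Set.Ioc (0 : ℝ) (1 / 4), ∀ γ ∈ Set.Icc (5 : ℝ) 8, C * Real.exp (sawSigmaStar * γ) < γ ^ 2 - 3 →
      (CascadeFieldSmooth ⟨γ, δ₀, 2, 1, 2⟩ ∧ K1Localised ⟨γ, δ₀, 2, 1, 2⟩ (γ ^ 2 - 3)) →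
      K2PhaseGrowthClassical ⟨γ, δ₀, 2, 1, 2⟩ C → Target :=
  fun δ₀ hδ₀ γ hγ hCr h1 hK2 => target_of_k1Localised_PC ⟨γ, δ₀, 2, 1, 2⟩ hγ hδ₀.1 rfl rfl rfl hC0 hCr h1.2 hK2

/-! ## The weakest K2 the closure consumes: a cap WITHIN THE HORIZON (`K2PhaseGrowthClassicalH`; sequel) -/

/-- **`Target` from K1loc and a K2-cap within the horizon at one point** (`P.γ ∈ [5,8]`, `0 < P.δ₀`,
`(P.d, P.N₀, P.ρN) = (2,1,2)`, `0 ≤ C`, `C·e^{σ⋆ P.γ} < P.γ² − 3`): `K1Localised P (P.γ²−3)` and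
`K2PhaseGrowthClassicalH P C` (the per-phase cap `(C e^{σ⋆γ})^{J+1−j₀}` of the classical linearised cascade assumed only
for phases `j₀ ≤ J < J_{P.γ²−3}(ν) + A` below the horizon, threshold `ν₀(A)` per lag) imply `Target`
(`target_of_approxSol_params` with `LipAgmon.approximateSolution_PH`). -/
theorem target_of_k1Localised_PH (P : CascadeParams) (hγ : P.γ ∈ Set.Icc (5 : ℝ) 8) (hδ₀ : 0 < P.δ₀) (hd : P.d = 2)
    (hN₀ : P.N₀ = 1) (hρN : P.ρN = 2) {C : ℝ} (hC0 : 0 ≤ C) (hCr : C * Real.exp (sawSigmaStar * P.γ) < P.γ ^ 2 - 3)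
    (hK1 : K1Localised P (P.γ ^ 2 - 3)) (hK2 : K2PhaseGrowthClassicalH P C) : Target := by
  obtain ⟨γ, δ₀, d, N₀, ρN⟩ := P
  simp only at hγ hδ₀ hd hN₀ hρN hCr hK1
  subst hd hN₀ hρN
  exact target_of_approxSol_params ⟨γ, δ₀, 2, 1, 2⟩ hδ₀ (by norm_num) le_rfl le_rfl (cascadeFieldSmooth _ hδ₀ (by norm_num))
    hK1 (LipAgmon.approximateSolution_PH hγ hδ₀ hC0 hCr hK2)

/-- **Pointwise closure, horizon form** (shape-Q support item `PointClosureCtgH`, any `δ₀ > 0`): at `⟨8, δ₀, 2, 1, 2⟩`,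
`K1Localised` and `K2PhaseGrowthClassicalH · 5` give `Target` (`cap_window_eight`: `5·e^{8σ⋆} < 61`). -/
theorem pointClosureH {δ₀ : ℝ} (hδ₀ : 0 < δ₀) (hK1 : K1Localised ⟨8, δ₀, 2, 1, 2⟩ (8 ^ 2 - 3))
    (hK2 : K2PhaseGrowthClassicalH ⟨8, δ₀, 2, 1, 2⟩ 5) : Target :=
  target_of_k1Localised_PH ⟨8, δ₀, 2, 1, 2⟩ ⟨by norm_num, by norm_num⟩ hδ₀ rfl rfl rfl (by norm_num)
    (cap_window_eight le_rfl) hK1 hK2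

/-- **The route modulo a K2-cap `C ≤ 5` within the horizon at the K1loc′ point** (`P.γ = 8`, `0 < P.δ₀ ≤ 2⁻¹⁰⁰`,
`(P.d, P.N₀, P.ρN) = (2,1,2)`; K1loc′ = `K1Window.k1Localised_ctg`, p663045): `K2PhaseGrowthClassicalH P C → Target`. -/
theorem target_of_K2H_at_ctg_point (P : CascadeParams) (hγ : P.γ = 8) (hδ₀ : 0 < P.δ₀)
    (hδ₀' : P.δ₀ ≤ (2 : ℝ)⁻¹ ^ 100) (hd : P.d = 2) (hN₀ : P.N₀ = 1) (hρN : P.ρN = 2) {C : ℝ} (hC0 : 0 ≤ C)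
    (hC5 : C ≤ 5) (hK2 : K2PhaseGrowthClassicalH P C) : Target := by
  have hCr : C * Real.exp (sawSigmaStar * P.γ) < P.γ ^ 2 - 3 := by rw [hγ]; exact cap_window_eight hC5
  exact target_of_k1Localised_PH P (by rw [hγ]; norm_num) hδ₀ hd hN₀ hρN hC0 hCr
    (K1Window.k1Localised_ctg P hγ hδ₀ hδ₀' hd hN₀ hρN) hK2

/-- **Headline — the weakest K2 of record.**  `K2PhaseGrowthClassicalH ⟨8, δ₀, 2, 1, 2⟩ 5 → Target` for every corner
rounding `δ₀ ∈ (0, 2⁻¹⁰⁰]`: if for every lag `A` there is `ν₀(A) > 0` such that for `ν ∈ (0, ν₀]`, all phases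
`j₀ ≤ J < J_61(ν) + A` (below the horizon — there `16π²νN_J²tHalf_J ≤ δ_J²`), both halves, every residual-comb datum at
phase `j₀` and every CLASSICAL solution of Navier–Stokes linearised at the cascade, `‖w(t)‖² ≤ (5e^{8σ⋆})^{2(J+1−j₀)}‖w₀‖²`
during phase `J` — then the rung `Target` (Brué–De Lellis Q2.1 with a Hölder force) holds. -/
theorem target_of_K2H_five {δ₀ : ℝ} (hδ₀ : 0 < δ₀) (hδ₀' : δ₀ ≤ (2 : ℝ)⁻¹ ^ 100)
    (hK2 : K2PhaseGrowthClassicalH ⟨8, δ₀, 2, 1, 2⟩ 5) : Target :=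
  target_of_K2H_at_ctg_point ⟨8, δ₀, 2, 1, 2⟩ rfl hδ₀ hδ₀' rfl rfl rfl (by norm_num) le_rfl hK2

/-- **The restated route-2 crux (shape Q v2, arbiter A25-8) implies `Target`**:
`K2GrowthCtgPointH := ∃ δ₀ ∈ Ioc 0 2⁻¹⁰⁰, K2PhaseGrowthClassicalH ⟨8, δ₀, 2, 1, 2⟩ 5`. -/
theorem target_of_K2GrowthCtgPointH
    (hK2 : ∃ δ₀ ∈ Set.Ioc (0 : ℝ) ((2 : ℝ)⁻¹ ^ 100), K2PhaseGrowthClassicalH ⟨8, δ₀, 2, 1, 2⟩ 5) : Target := by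
  obtain ⟨δ₀, hδ₀, h⟩ := hK2
  exact target_of_K2H_five hδ₀.1 hδ₀.2 h

/-- Every stronger K2 statement still closes: the all-phases cap `K2PhaseGrowthClassical ⟨8,δ₀,2,1,2⟩ C`, `0 ≤ C ≤ 5`, at
one `δ₀ ∈ (0, 2⁻¹⁰⁰]` implies `Target` (`K2PhaseGrowthClassical.within`). -/
theorem target_of_K2cap_le_five {δ₀ C : ℝ} (hδ₀ : 0 < δ₀) (hδ₀' : δ₀ ≤ (2 : ℝ)⁻¹ ^ 100) (hC0 : 0 ≤ C) (hC5 : C ≤ 5)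
    (hK2 : K2PhaseGrowthClassical ⟨8, δ₀, 2, 1, 2⟩ C) : Target :=
  target_of_K2H_at_ctg_point ⟨8, δ₀, 2, 1, 2⟩ rfl hδ₀ hδ₀' rfl rfl rfl hC0 hC5 hK2.within

end Summit.AnomalousDissipation.AnomalousDissipation.Theorems.SawtoothPulseCascade

end
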